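import Mathlib

/-!
# The pencil lemma: a first-order criterion for `A + t·B` to have independent rows for some `t`

Helper file for crux `stmt-CriticalPhenomena-4575` (`NoHeavyLowerTail`, route `PercNearOneGluingNoHeavy`),
new-inequality factory seat `prim-ineq-gen-3` (gen 19).  Everything here is PROVED; no definitions.

Gen 19's CONJECTURE `TYPE-t` (memo `run/shared/lean/prim/prim-ineq-gen-3/CONJECTURE-TYPET.md`) asserts that the weighted rows
`u_s = [E ⊆ s] + t·[E ∩ s = ∅]` are linearly independent for a suitable parameter `t`; such a certificate feeds the sockets of
`…OrientedAntipodalHallTypeTSocket` (`MS3′` count, W2 count, Hall).  The rows form a PENCIL `A i + t • B i`.  This file proves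
the elementary criterion reducing the parametric statement to a parameter-free one (criterion `C0` of the memo, §3):

* `pencil_solutions_aux` — if every vector `d` in the left kernel of `A` whose `B`-image lies in the row space
  of `A` vanishes, then solution vectors `d_t` of `∑ i, d_t i • (A i + t • B i) = 0` for DISTINCT non-zero parameters `t` are
  linearly independent: a vanishing combination has all its terms `c t • d_t` zero (an eigenvector-type argument, no determinants;
  `sum_sum_smul_smul` is the bookkeeping identity);
* `exists_linearIndependent_add_smul` — consequently, over an infinite field some `t` makes the rows `A i + t • B i` linearly
  independent (indeed all but at most `card ι + 1` values of `t` do).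
(prim-ineq-gen-3 gen 19, 2026-08-23.)
-/

namespace Summit.CriticalPhenomena.PercolationContinuityZ3.Theorems

namespace OrientedAntipodalHall

open Finset

variable {K : Type*} [Field K] {ι : Type*} [Fintype ι] {M : Type*} [AddCommGroup M] [Module K M]

/-- Swapping a finite linear combination of coefficient vectors through a linear combination of rows. -/
theorem sum_sum_smul_smul (A : ι → M) (d : K → ι → K) (e : K → K) (T : Finset K) :
    ∑ i, (∑ u ∈ T, e u • d u) i • A i = ∑ u ∈ T, e u • ∑ i, d u i • A i := by
  have h1 : ∀ i, (∑ u ∈ T, e u • d u) i • A i = ∑ u ∈ T, e u • (d u i • A i) := by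
    intro i
    rw [Finset.sum_apply, Finset.sum_smul]
    refine Finset.sum_congr rfl fun u _ => ?_
    rw [Pi.smul_apply, smul_eq_mul, mul_smul]
  rw [Finset.sum_congr rfl fun i _ => h1 i, Finset.sum_comm]
  refine Finset.sum_congr rfl fun u _ => ?_
  rw [Finset.smul_sum]

/-- **Solutions of the pencil at distinct non-zero parameters are independent.**  Let `A B : ι → M` and assume the criterion
`C0`: every `d` with `∑ d i • A i = 0` and `∑ d i • B i ∈ span (range A)` is zero.  If `d t` (`t ∈ s`) satisfy
`∑ i, d t i • (A i + t • B i) = 0` for the distinct non-zero scalars `t ∈ s`, then any vanishing combination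
`∑_{t ∈ s} c t • d t = 0` has `c t • d t = 0` for every `t ∈ s`. -/
theorem pencil_solutions_aux (A B : ι → M)
    (hC0 : ∀ d : ι → K, ∑ i, d i • A i = 0 → (∑ i, d i • B i) ∈ Submodule.span K (Set.range A) → d = 0)
    (d : K → ι → K) (s : Finset K) (hs0 : (0 : K) ∉ s)
    (hsol : ∀ t ∈ s, ∑ i, d t i • (A i + t • B i) = 0) :
    ∀ c : K → K, ∑ t ∈ s, c t • d t = 0 → ∀ t ∈ s, c t • d t = 0 := by
  classical
  -- the two identities `∑ d t i • A i = -t • ∑ d t i • B i`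
  have hAB : ∀ t ∈ s, ∑ i, d t i • A i = -(t • ∑ i, d t i • B i) := by
    intro t ht
    have h := hsol t ht
    simp only [smul_add, sum_add_distrib, smul_comm (d t _) t, ← smul_sum] at h
    exact eq_neg_of_add_eq_zero_left h
  induction s using Finset.induction_on with
  | empty => intro c _ t ht; simp at ht
  | @insert t₀ s ht₀ ih =>
    intro c hc t ht
    have hs0' : (0 : K) ∉ s := fun h => hs0 (mem_insert_of_mem h)
    have hsol' : ∀ t ∈ s, ∑ i, d t i • (A i + t • B i) = 0 := fun t ht => hsol t (mem_insert_of_mem ht)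
    have hAB' : ∀ t ∈ s, ∑ i, d t i • A i = -(t • ∑ i, d t i • B i) := fun t ht => hAB t (mem_insert_of_mem ht)
    have ht₀0 : t₀ ≠ 0 := fun h => hs0 (h ▸ mem_insert_self t₀ s)
    have hne0 : ∀ u ∈ insert t₀ s, u ≠ 0 := fun u hu h => hs0 (h ▸ hu)
    -- the rescaled combination `d* = ∑ (c u / u) • d u` lies in the left kernel of `A` with `B`-image in the row space
    set dstar : ι → K := ∑ u ∈ insert t₀ s, (c u / u) • d u with hdstar
    have hA : ∑ i, dstar i • A i = 0 := by
      have : ∑ i, dstar i • A i = ∑ u ∈ insert t₀ s, (c u / u) • ∑ i, d u i • A i := by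
        rw [hdstar]; exact sum_sum_smul_smul A d (fun u => c u / u) _
      rw [this]
      have h2 : ∑ u ∈ insert t₀ s, (c u / u) • ∑ i, d u i • A i =
          -(∑ u ∈ insert t₀ s, c u • ∑ i, d u i • B i) := by
        rw [← sum_neg_distrib]
        refine sum_congr rfl fun u hu => ?_
        rw [hAB u hu, smul_neg, smul_smul, div_mul_cancel₀ _ (hne0 u hu)]
      rw [h2, neg_eq_zero]
      have h3 : ∑ u ∈ insert t₀ s, c u • ∑ i, d u i • B i = ∑ i, (∑ u ∈ insert t₀ s, c u • d u) i • B i :=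
        (sum_sum_smul_smul B d c _).symm
      rw [h3, hc]
      simp
    have hB : (∑ i, dstar i • B i) ∈ Submodule.span K (Set.range A) := by
      have : ∑ i, dstar i • B i = ∑ u ∈ insert t₀ s, (c u / u) • ∑ i, d u i • B i := by
        rw [hdstar]; exact sum_sum_smul_smul B d (fun u => c u / u) _
      rw [this]
      refine Submodule.sum_mem _ fun u hu => ?_
      -- `∑ d u i • B i = -(1/u) • ∑ d u i • A i ∈ span (range A)`
      have hu0 := hne0 u hu
      have hBu : ∑ i, d u i • B i = -(u⁻¹ • ∑ i, d u i • A i) := by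
        rw [hAB u hu, smul_neg, smul_smul, inv_mul_cancel₀ hu0, one_smul, neg_neg]
      rw [hBu]
      refine Submodule.smul_mem _ _ (Submodule.neg_mem _ (Submodule.smul_mem _ _ ?_))
      exact Submodule.sum_mem _ fun i _ => Submodule.smul_mem _ _ (Submodule.subset_span (Set.mem_range_self i))
    have hzero : dstar = 0 := hC0 dstar hA hB
    -- new relation with zero coefficient at `t₀`: `c'' u = c u / u - c u / t₀`
    set c'' : K → K := fun u => c u / u - c u / t₀ with hc''
    have hrel : ∑ u ∈ s, c'' u • d u = 0 := by
      have h1 : ∑ u ∈ insert t₀ s, c'' u • d u = 0 := by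
        have : ∑ u ∈ insert t₀ s, c'' u • d u = dstar - t₀⁻¹ • ∑ u ∈ insert t₀ s, c u • d u := by
          rw [hdstar, smul_sum, ← sum_sub_distrib]
          refine sum_congr rfl fun u _ => ?_
          rw [hc'', sub_smul, smul_smul, div_eq_mul_inv (c u) t₀, mul_comm (c u) t₀⁻¹]
        rw [this, hzero, hc, smul_zero, sub_zero]
      rw [sum_insert ht₀] at h1
      have hct₀ : c'' t₀ = 0 := by simp [hc'']
      rwa [hct₀, zero_smul, zero_add] at h1
    have ih' := ih hs0' hsol' hAB' c'' hrel
    -- conclude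
    rcases mem_insert.mp ht with rfl | ht'
    · -- `t = t₀`: all other terms vanish
      have hothers : ∀ u ∈ s, c u • d u = 0 := by
        intro u hu
        have h := ih' u hu
        have hu0 : u ≠ 0 := fun h0 => hs0' (h0 ▸ hu)
        have hut : u ≠ t := fun h0 => ht₀ (h0 ▸ hu)
        have hcoef : c'' u = c u * (u⁻¹ - t⁻¹) := by rw [hc'']; ring
        rw [hcoef, mul_smul] at h
        rcases smul_eq_zero.mp h with hcu | hrest
        · rw [hcu, zero_smul]
        · rcases smul_eq_zero.mp hrest with hinv | hdu
          · exact absurd (inv_injective (sub_eq_zero.mp hinv)) hut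
          · rw [hdu, smul_zero]
      have h := hc
      rw [sum_insert ht₀, sum_eq_zero hothers, add_zero] at h
      exact h
    · have h := ih' t ht'
      have hu0 : t ≠ 0 := fun h0 => hs0' (h0 ▸ ht')
      have hut : t ≠ t₀ := fun h0 => ht₀ (h0 ▸ ht')
      have hcoef : c'' t = c t * (t⁻¹ - t₀⁻¹) := by rw [hc'']; ring
      rw [hcoef, mul_smul] at h
      rcases smul_eq_zero.mp h with hcu | hrest
      · rw [hcu, zero_smul]
      · rcases smul_eq_zero.mp hrest with hinv | hdu
        · exact absurd (inv_injective (sub_eq_zero.mp hinv)) hut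
        · rw [hdu, smul_zero]

/-- **Pencil lemma (criterion `C0` ⟹ some parameter works).**  Over an infinite field, if every `d` with `∑ d i • A i = 0` and
`∑ d i • B i ∈ span (range A)` vanishes, then for some scalar `t` the rows `A i + t • B i` are linearly independent. -/
theorem exists_linearIndependent_add_smul [Infinite K] (A B : ι → M)
    (hC0 : ∀ d : ι → K, ∑ i, d i • A i = 0 → (∑ i, d i • B i) ∈ Submodule.span K (Set.range A) → d = 0) :
    ∃ t : K, LinearIndependent K (fun i => A i + t • B i) := by
  classical
  by_contra hall
  have hall' : ∀ t : K, ¬ LinearIndependent K (fun i => A i + t • B i) := fun t ht => hall ⟨t, ht⟩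
  -- for every `t` choose a non-trivial solution
  have hsol : ∀ t : K, ∃ g : ι → K, ∑ i, g i • (A i + t • B i) = 0 ∧ g ≠ 0 := by
    intro t
    obtain ⟨g, hg, i, hi⟩ := Fintype.not_linearIndependent_iff.mp (hall' t)
    exact ⟨g, hg, fun h => hi (by rw [h]; rfl)⟩
  choose d hd hdne using hsol
  -- a finite set `s` of more than `card ι` distinct non-zero scalars
  let f := Infinite.natEmbedding K
  set s : Finset K := ((Finset.range (Fintype.card ι + 2)).image f).erase 0 with hs
  have hs0 : (0 : K) ∉ s := by rw [hs]; exact Finset.notMem_erase 0 _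
  have hcard : Fintype.card ι + 1 ≤ s.card := by
    have h1 : ((Finset.range (Fintype.card ι + 2)).image f).card = Fintype.card ι + 2 := by
      rw [Finset.card_image_of_injective _ f.injective, Finset.card_range]
    have h2 := Finset.pred_card_le_card_erase (s := (Finset.range (Fintype.card ι + 2)).image f) (a := (0 : K))
    rw [h1] at h2
    rw [hs]
    omega
  -- the chosen solutions on `s` are linearly independent
  have haux := pencil_solutions_aux A B hC0 d s hs0 (fun t _ => hd t)
  have hli : LinearIndependent K (fun t : s => d (t : K)) := by
    rw [Fintype.linearIndependent_iff]
    intro g hg t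
    let c : K → K := fun u => if h : u ∈ s then g ⟨u, h⟩ else 0
    have hc : ∑ u ∈ s, c u • d u = 0 := by
      rw [← Finset.sum_coe_sort]
      have : ∀ x : s, c (x : K) • d (x : K) = g x • d (x : K) := by
        intro x
        simp [c, x.2]
      rw [Finset.sum_congr rfl fun x _ => this x]
      exact hg
    have h := haux c hc t t.2
    have hct : c (t : K) = g t := by simp [c, t.2]
    rw [hct] at h
    rcases smul_eq_zero.mp h with h0 | h0
    · exact h0
    · exact absurd h0 (hdne _)
  have hle := hli.fintype_card_le_finrank
  rw [Module.finrank_fintype_fun_eq_card, Fintype.card_coe] at hle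
  omega

end OrientedAntipodalHall

end Summit.CriticalPhenomena.PercolationContinuityZ3.Theorems
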